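import Mathlib
import Summits.ValiantsHypothesis.ValiantsHypothesis.Theorems.NewtonUnitEquationsNewtonTauWeakHexagonDelta
import Summits.ValiantsHypothesis.ValiantsHypothesis.Theorems.NewtonUnitEquationsNewtonTauWeakHexagonSeparated
import Summits.ValiantsHypothesis.ValiantsHypothesis.Theorems.NewtonUnitEquationsNewtonTauWeakHexagonAllK

/-!
# `NewtonUnitEquationsNewtonTauWeakSepDeltaIter` — iterated `Δ` on separated polynomials (sharp rank)

Rung toward `stub_binomialNewtonTauCommon` (crux `NewtonTauWeak`, stmt-ValiantsHypothesis-5904), line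
`binomial-normal-form`: registered stub `stub_sepDeltaIter`.

Conventions (spelled inline, no new definitions): `Δ` is ANY self-map of `ℂ[X,Y]` with the coefficient
law `coeff e (Δ p) = (e₀ - e₁) · coeff e p` (the Euler derivation `X∂_X - Y∂_Y`) and the Leibniz rule;
"x-only" `P` means `∀ e ∈ P.support, e 1 = 0`, "y-only" `∀ e ∈ Q.support, e 0 = 0`; "separated of
rank `R`" means `m = Σ_{r<R} P_r · Q_r` with `P_r` x-only and `Q_r` y-only.

`hex_sep_delta` (`…HexagonSeparated`) gives `Δ (Sep R) ⊆ Sep (2R)`, whence only `Δ^n (Sep R) ⊆ Sep (2^n R)`.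
This file is the sharp version `Δ^n (Sep R) ⊆ Sep ((n+1) R)`: by the iterated Leibniz rule
`Δ^n (P Q) = Σ_{i ≤ n} (n choose i) · Δ^i P · Δ^{n-i} Q` (`HexagonSepDeltaIter.delta_iterate_mul`, the
proof of Mathlib's `Polynomial.iterate_derivative_mul` for the abstract `Δ`) and since `Δ^i` does not
enlarge supports, `Δ^n (Σ_{r<R} P_r Q_r) = Σ_r Σ_{i ≤ n} ((n choose i) Δ^i P_r) · (Δ^{n-i} Q_r)` is
separated of rank `(n+1) R`. [folklore]
-/

set_option linter.dupNamespace false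

noncomputable section

namespace Summit.ValiantsHypothesis.ValiantsHypothesis.Theorems.NewtonUnitEquationsNewtonTauWeak

open scoped BigOperators
open MvPolynomial

namespace HexagonSepDeltaIter

/-- `Δ` commutes with natural-number multiples (coefficient law). [folklore] -/
theorem delta_nsmul (Δ : MvPolynomial (Fin 2) ℂ → MvPolynomial (Fin 2) ℂ)
    (hΔ : ∀ p e, coeff e (Δ p) = (((e 0 : ℕ) : ℂ) - ((e 1 : ℕ) : ℂ)) * coeff e p)
    (c : ℕ) (p : MvPolynomial (Fin 2) ℂ) : Δ (c • p) = c • Δ p := by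
  rw [nsmul_eq_mul, nsmul_eq_mul, ← map_natCast (C : ℂ →+* MvPolynomial (Fin 2) ℂ) c,
    hex_delta_C_mul Δ hΔ]

/-- **Iterated Leibniz rule** for `Δ` (coefficient law + Leibniz as hypotheses):
`Δ^n (p q) = Σ_{i ≤ n} (n choose i) · Δ^i p · Δ^{n-i} q`. [folklore] -/
theorem delta_iterate_mul (Δ : MvPolynomial (Fin 2) ℂ → MvPolynomial (Fin 2) ℂ)
    (hΔ : ∀ p e, coeff e (Δ p) = (((e 0 : ℕ) : ℂ) - ((e 1 : ℕ) : ℂ)) * coeff e p)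
    (hL : ∀ p q, Δ (p * q) = Δ p * q + p * Δ q) (n : ℕ) (p q : MvPolynomial (Fin 2) ℂ) :
    (Δ^[n]) (p * q) =
      ∑ i ∈ Finset.range (n + 1), n.choose i • ((Δ^[i]) p * (Δ^[n - i]) q) := by
  induction n with
  | zero => simp
  | succ n ih =>
    rw [Function.iterate_succ_apply', ih, HexagonTrichotomy.delta_sum' Δ hΔ]
    refine Eq.trans ?_
      (Finset.sum_choose_succ_nsmul (fun i j => (Δ^[i]) p * (Δ^[j]) q) n).symm
    rw [← Finset.sum_add_distrib]
    refine Finset.sum_congr rfl fun i hi => ?_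
    rw [Finset.mem_range, Nat.lt_succ_iff] at hi
    rw [delta_nsmul Δ hΔ, hL, smul_add, ← Function.iterate_succ_apply' Δ i p,
      ← Function.iterate_succ_apply' Δ (n - i) q, Nat.succ_eq_add_one, Nat.succ_eq_add_one,
      ← Nat.sub_add_comm hi]
    exact add_comm _ _

end HexagonSepDeltaIter

open HexagonSepDeltaIter in
/-- **Iterated `Δ` on separated polynomials, sharp rank.** If `m = Σ_{r<R} P_r · Q_r` is separated of
rank `R` (`P_r` x-only, `Q_r` y-only), then `Δ^n m` is separated of rank `(n+1) · R`: by the iterated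
Leibniz rule `Δ^n (P_r Q_r) = Σ_{i ≤ n} (n choose i) Δ^i P_r · Δ^{n-i} Q_r`, and `Δ^i` preserves x-only /
y-only supports. [folklore] -/
theorem stub_sepDeltaIter (Δ : MvPolynomial (Fin 2) ℂ → MvPolynomial (Fin 2) ℂ)
    (hΔ : ∀ p e, coeff e (Δ p) = (((e 0 : ℕ) : ℂ) - ((e 1 : ℕ) : ℂ)) * coeff e p)
    (hL : ∀ p q, Δ (p * q) = Δ p * q + p * Δ q)
    {R : ℕ} {m : MvPolynomial (Fin 2) ℂ} (n : ℕ)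
    (hm : ∃ P Q : Fin R → MvPolynomial (Fin 2) ℂ, (∀ r, ∀ e ∈ (P r).support, e 1 = 0) ∧
      (∀ r, ∀ e ∈ (Q r).support, e 0 = 0) ∧ m = ∑ r, P r * Q r) :
    ∃ P Q : Fin ((n + 1) * R) → MvPolynomial (Fin 2) ℂ, (∀ r, ∀ e ∈ (P r).support, e 1 = 0) ∧
      (∀ r, ∀ e ∈ (Q r).support, e 0 = 0) ∧ (Δ^[n]) m = ∑ r, P r * Q r := by
  obtain ⟨P, Q, hP, hQ, rfl⟩ := hm
  -- iterates of `Δ` do not enlarge supports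
  have hsub : ∀ (k : ℕ) (p : MvPolynomial (Fin 2) ℂ), ((Δ^[k]) p).support ⊆ p.support := by
    intro k
    induction k with
    | zero => exact fun p => Finset.Subset.refl _
    | succ k ih =>
      intro p
      rw [Function.iterate_succ_apply']
      exact (hex_support_delta_subset Δ hΔ _).trans (ih p)
  -- index `(i, r) ∈ Fin (n+1) × Fin R` along `finProdFinEquiv`
  refine ⟨fun k => n.choose ((finProdFinEquiv.symm k).1 : ℕ) •
      (Δ^[((finProdFinEquiv.symm k).1 : ℕ)]) (P (finProdFinEquiv.symm k).2),
    fun k => (Δ^[n - ((finProdFinEquiv.symm k).1 : ℕ)]) (Q (finProdFinEquiv.symm k).2),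
    fun k e he => hP _ e (hsub _ _ (support_smul he)), fun k e he => hQ _ e (hsub _ _ he), ?_⟩
  symm
  calc ∑ k : Fin ((n + 1) * R), n.choose ((finProdFinEquiv.symm k).1 : ℕ) •
          (Δ^[((finProdFinEquiv.symm k).1 : ℕ)]) (P (finProdFinEquiv.symm k).2) *
          (Δ^[n - ((finProdFinEquiv.symm k).1 : ℕ)]) (Q (finProdFinEquiv.symm k).2)
      = ∑ x : Fin (n + 1) × Fin R, n.choose (x.1 : ℕ) •
          ((Δ^[(x.1 : ℕ)]) (P x.2) * (Δ^[n - (x.1 : ℕ)]) (Q x.2)) :=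
        Fintype.sum_equiv finProdFinEquiv.symm _ _ fun k => smul_mul_assoc _ _ _
    _ = ∑ i : Fin (n + 1), ∑ r, n.choose (i : ℕ) • ((Δ^[(i : ℕ)]) (P r) * (Δ^[n - (i : ℕ)]) (Q r)) :=
        Fintype.sum_prod_type _
    _ = ∑ r, ∑ i : Fin (n + 1), n.choose (i : ℕ) • ((Δ^[(i : ℕ)]) (P r) * (Δ^[n - (i : ℕ)]) (Q r)) :=
        Finset.sum_comm
    _ = ∑ r, (Δ^[n]) (P r * Q r) := Finset.sum_congr rfl fun r _ => by
        rw [delta_iterate_mul Δ hΔ hL, Finset.sum_range]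
    _ = (Δ^[n]) (∑ r, P r * Q r) := (HexagonAllK.delta_iterate_sum Δ hΔ n _ _).symm

end Summit.ValiantsHypothesis.ValiantsHypothesis.Theorems.NewtonUnitEquationsNewtonTauWeak

end
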